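import Literature.AlgebraicGeometry.Deformation.SmoothSchemeLiftObstructionCechCocycle
import HarnessLib

/-!
# Base change of lifted gluing data along a map of coefficient algebras
# (Hartshorne, *Deformation Theory*, proof of Thm. 10.2 (a): «`X'_R` restricts to `X'_{R'}`» at the level of the transition automorphisms)

Topic `Literature/AlgebraicGeometry/Deformation`; namespace `Literature.AlgebraicGeometry.Deformation`.
THEOREMS ONLY (no definition, no named fact, no instance, no notation, no `sorry`; net Literature debt 0).
Cell hodgecm-mathlib (D-0151), F-11 sub-line F0∕P1b, brick **B5** of F0P1b-plan (g0) (R53) for F0P1b-p03 (g0)'s MONO-G2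
assembly and B-p21's glue files (their FIT): «reduction of admissible cocycle-exact transition data along `σ : R →ₐ[k] R'`».
HC_CM is proved only modulo the 7 printed citations until rung 0 closes; this file discharges none of them.

CURRENCY (★ `SmoothSchemeLiftObstructionCechCocycle`, ★ `SmoothSchemeLiftObstructionCriterionGlueDatum`): `k` a field,
`X : Over (Spec k)` with compatible `k`-structures `halg` on its sections, a principal affine cover `U`, `U j ∩ U l = D(b j l)`;
lifted gluing data over a `k`-algebra `R` = `R`-algebra automorphisms `ψ j l` of `R ⊗_k Γ(U j ∩ U l)`, ADMISSIBLE
(`ψ ≡ 1 mod 𝔫`, `𝔫` nilpotent) and COCYCLE-EXACT (`hcoc`: for all base-change maps `Φ` to the triple overlap and all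
compatible restrictions `ρ`, `ρ_{lm} ρ_{jl} = ρ_{jm}`).

* §1 (one ring) `exists_algEquiv_baseChange` — along `σ : R →ₐ[k] R'` every `R`-automorphism `u` of `R ⊗_k B` has a
  base change `u'`, an `R'`-automorphism of `R' ⊗_k B` with `(σ ⊗ 1) ∘ u = u' ∘ (σ ⊗ 1)` (`u' = R' ⊗_R u` through
  Mathlib `Algebra.TensorProduct.cancelBaseChange`); `algEquiv_baseChange_unique` (it is determined by that identity),
  `algEquiv_baseChange_mul`, `sub_mem_smul_top_of_baseChange` (admissibility passes to `u'` for any `𝔫' ⊇ σ(𝔫)`);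
* §2 `baseChangeMap_comp_map_eq` — restriction to a smaller open commutes with `σ ⊗ 1`;
* §3 **`exists_baseChange_gluingData`** — the cover-level statement: admissible cocycle-exact data `ψ` over `R` have a
  base change `ψ'` over `R'`, admissible for any nilpotent `𝔫' ⊇ σ(𝔫)`, COCYCLE-EXACT (the restrictions of `ψ'` are the
  base changes of the restrictions of `ψ`, by ★ `exists_algEquiv_restrict` ∕ `algEquiv_restrict_unique`), and compatible:
  `(σ ⊗ 1) (ψ j l x) = ψ' j l ((σ ⊗ 1) x)` — the `hψσ` hypothesis of ★ `SmoothSchemeLiftObstructionCriterionGlueReduction` ∕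
  `…GluePullback`.

## References
* [Hartshorne2010] R. Hartshorne, *Deformation Theory*, GTM 257 (2010): Thm. 10.2 (a) and its proof (p. 81).
* [StacksProject] The Stacks Project, Tag 01JA (glueing schemes, functoriality), Tag 05GG∕00DK (base change of algebras).
* [AtiyahMacdonald1969] M. F. Atiyah, I. G. Macdonald, *Introduction to Commutative Algebra* (1969), Ch. 2 (pp. 30–31), Ex. 2.15.
-/

noncomputable section

set_option backward.isDefEq.respectTransparency false

open CategoryTheory AlgebraicGeometry Opposite TopologicalSpace
open scoped TensorProduct

universe u

namespace Literature.AlgebraicGeometry.Deformation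

open Literature.AlgebraicGeometry.Motives Literature.AlgebraicGeometry.Morphisms

/-! ## §1 Base change of an automorphism of `R ⊗_k B` along `σ : R → R'` -/

section OneRing

variable {k : Type u} [CommRing k] {R R' : Type u} [CommRing R] [CommRing R'] [Algebra k R] [Algebra k R']
  (σ : R →ₐ[k] R') {B : Type u} [CommRing B] [Algebra k B]

/-- **Base change of an `R`-automorphism of `R ⊗_k B` along `σ : R → R'`**: there is an `R'`-automorphism `u'` of
`R' ⊗_k B` with `(σ ⊗ 1) ∘ u = u' ∘ (σ ⊗ 1)` — namely `R' ⊗_R u` transported through `R' ⊗_R (R ⊗_k B) = R' ⊗_k B`.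
[cite: AtiyahMacdonald1969, Ch. 2 (pp. 30–31) and Ex. 2.15] [cite: Hartshorne2010, Thm. 10.2 (a), proof (p. 81)] -/
theorem exists_algEquiv_baseChange (u : R ⊗[k] B ≃ₐ[R] R ⊗[k] B) :
    ∃ u' : R' ⊗[k] B ≃ₐ[R'] R' ⊗[k] B, ∀ x,
      u' (Algebra.TensorProduct.map σ (AlgHom.id k B) x) = Algebra.TensorProduct.map σ (AlgHom.id k B) (u x) := by
  letI : Algebra R R' := σ.toRingHom.toAlgebra
  haveI : IsScalarTower k R R' := IsScalarTower.of_algebraMap_eq fun x => (σ.commutes x).symm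
  let c : R' ⊗[R] (R ⊗[k] B) ≃ₐ[R'] R' ⊗[k] B := Algebra.TensorProduct.cancelBaseChange k R R' R' B
  let v : R' ⊗[R] (R ⊗[k] B) ≃ₐ[R'] R' ⊗[R] (R ⊗[k] B) :=
    Algebra.TensorProduct.congr (AlgEquiv.refl : R' ≃ₐ[R'] R') u
  have hc : ∀ y : R ⊗[k] B, c ((1 : R') ⊗ₜ[R] y) = Algebra.TensorProduct.map σ (AlgHom.id k B) y := by
    intro y
    induction y using TensorProduct.induction_on with
    | zero => simp
    | tmul s b =>
        rw [Algebra.TensorProduct.cancelBaseChange_tmul, Algebra.TensorProduct.map_tmul, AlgHom.id_apply,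
          Algebra.smul_def, mul_one]
        rfl
    | add y z hy hz => rw [TensorProduct.tmul_add, map_add, hy, hz, map_add]
  refine ⟨(c.symm.trans v).trans c, fun x => ?_⟩
  have h1 : c.symm (Algebra.TensorProduct.map σ (AlgHom.id k B) x) = (1 : R') ⊗ₜ[R] x := by
    rw [AlgEquiv.symm_apply_eq, hc]
  rw [AlgEquiv.trans_apply, AlgEquiv.trans_apply, h1]
  change c (Algebra.TensorProduct.congr (AlgEquiv.refl : R' ≃ₐ[R'] R') u ((1 : R') ⊗ₜ[R] x)) = _
  rw [Algebra.TensorProduct.congr_apply, Algebra.TensorProduct.map_tmul]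
  change c ((1 : R') ⊗ₜ[R] u x) = _
  exact hc (u x)

/-- **The base change is determined by `(σ ⊗ 1) ∘ u = u' ∘ (σ ⊗ 1)`**: two `R'`-algebra automorphisms of `R' ⊗_k B`
agreeing on the image of `σ ⊗ 1` are equal (that image generates `R' ⊗_k B` as an `R'`-module).
[cite: AtiyahMacdonald1969, Ch. 2 (pp. 30–31)] -/
theorem algEquiv_baseChange_unique {u₁ u₂ : R' ⊗[k] B ≃ₐ[R'] R' ⊗[k] B}
    (h : ∀ x, u₁ (Algebra.TensorProduct.map σ (AlgHom.id k B) x) = u₂ (Algebra.TensorProduct.map σ (AlgHom.id k B) x)) :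
    u₁ = u₂ := by
  apply AlgEquiv.coe_toAlgHom_injective
  refine Algebra.TensorProduct.ext' fun r b => ?_
  have hb : (1 : R') ⊗ₜ[k] b = Algebra.TensorProduct.map σ (AlgHom.id k B) ((1 : R) ⊗ₜ[k] b) := by
    rw [Algebra.TensorProduct.map_tmul, map_one, AlgHom.id_apply]
  have hr : r ⊗ₜ[k] b = r • ((1 : R') ⊗ₜ[k] b) := by
    rw [TensorProduct.smul_tmul', smul_eq_mul, mul_one]
  change u₁ (r ⊗ₜ[k] b) = u₂ (r ⊗ₜ[k] b)
  rw [hr, map_smul, map_smul, hb, h]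

/-- Base change is multiplicative: base changes of `u`, `v` multiply to a base change of `u v`.
[cite: Hartshorne2010, Thm. 10.2 (a), proof (p. 81)] -/
theorem algEquiv_baseChange_mul {u v : R ⊗[k] B ≃ₐ[R] R ⊗[k] B} {u' v' : R' ⊗[k] B ≃ₐ[R'] R' ⊗[k] B}
    (hu : ∀ x, u' (Algebra.TensorProduct.map σ (AlgHom.id k B) x) = Algebra.TensorProduct.map σ (AlgHom.id k B) (u x))
    (hv : ∀ x, v' (Algebra.TensorProduct.map σ (AlgHom.id k B) x) = Algebra.TensorProduct.map σ (AlgHom.id k B) (v x))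
    (x : R ⊗[k] B) :
    (u' * v') (Algebra.TensorProduct.map σ (AlgHom.id k B) x) = Algebra.TensorProduct.map σ (AlgHom.id k B) ((u * v) x) := by
  rw [AlgEquiv.mul_apply, AlgEquiv.mul_apply, hv, hu]

/-- `σ ⊗ 1` is `σ`-semilinear: `(σ ⊗ 1)(n • m) = σ n • (σ ⊗ 1) m`. [cite: AtiyahMacdonald1969, Ch. 2 (pp. 30–31)] -/
theorem map_smul_eq_smul_map (n : R) (m : R ⊗[k] B) :
    Algebra.TensorProduct.map σ (AlgHom.id k B) (n • m) = σ n • Algebra.TensorProduct.map σ (AlgHom.id k B) m := by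
  rw [Algebra.smul_def, Algebra.smul_def, map_mul, Algebra.TensorProduct.algebraMap_apply,
    Algebra.TensorProduct.algebraMap_apply, Algebra.algebraMap_self, Algebra.algebraMap_self, RingHom.id_apply,
    RingHom.id_apply, Algebra.TensorProduct.map_tmul, map_one]

/-- **Admissibility passes to the base change**: if `u ≡ 1 (mod 𝔫)` and `σ(𝔫) ⊆ 𝔫'`, then `u' ≡ 1 (mod 𝔫')`.
[cite: Hartshorne2010, Thm. 10.2 (a), proof (p. 81)] -/
theorem sub_mem_smul_top_of_baseChange {𝔫 : Ideal R} {𝔫' : Ideal R'} (hσ : ∀ n ∈ 𝔫, σ n ∈ 𝔫')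
    {u : R ⊗[k] B ≃ₐ[R] R ⊗[k] B} (hu : ∀ x, u x - x ∈ 𝔫 • (⊤ : Submodule R (R ⊗[k] B)))
    {u' : R' ⊗[k] B ≃ₐ[R'] R' ⊗[k] B}
    (hu' : ∀ x, u' (Algebra.TensorProduct.map σ (AlgHom.id k B) x) = Algebra.TensorProduct.map σ (AlgHom.id k B) (u x))
    (y : R' ⊗[k] B) : u' y - y ∈ 𝔫' • (⊤ : Submodule R' (R' ⊗[k] B)) := by
  -- the image of `𝔫 • ⊤` under `σ ⊗ 1` lies in `𝔫' • ⊤`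
  have himg : ∀ w ∈ 𝔫 • (⊤ : Submodule R (R ⊗[k] B)),
      Algebra.TensorProduct.map σ (AlgHom.id k B) w ∈ 𝔫' • (⊤ : Submodule R' (R' ⊗[k] B)) := by
    intro w hw
    refine Submodule.smul_induction_on hw (fun n hn m _ => ?_) (fun w₁ w₂ h₁ h₂ => ?_)
    · rw [map_smul_eq_smul_map]
      exact Submodule.smul_mem_smul (hσ n hn) Submodule.mem_top
    · rw [map_add]; exact Submodule.add_mem _ h₁ h₂
  induction y using TensorProduct.induction_on with
  | zero => rw [map_zero, sub_self]; exact Submodule.zero_mem _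
  | tmul r b =>
      have hb : (1 : R') ⊗ₜ[k] b = Algebra.TensorProduct.map σ (AlgHom.id k B) ((1 : R) ⊗ₜ[k] b) := by
        rw [Algebra.TensorProduct.map_tmul, map_one, AlgHom.id_apply]
      have hr : r ⊗ₜ[k] b = r • ((1 : R') ⊗ₜ[k] b) := by
        rw [TensorProduct.smul_tmul', smul_eq_mul, mul_one]
      rw [hr, map_smul, ← smul_sub, hb, hu', ← map_sub]
      exact Submodule.smul_mem _ r (himg _ (hu _))
  | add y z hy hz =>
      rw [map_add, add_sub_add_comm]
      exact Submodule.add_mem _ hy hz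

end OneRing

/-! ## §2 Restriction commutes with `σ ⊗ 1` -/

section Cover

variable {k : Type u} [Field k] {X : Over (Spec (CommRingCat.of k))}
  [instΓ : ∀ W : X.left.Opens, Algebra k Γ(X.left, W)]
  (halg : ∀ (W : X.left.Opens) (s : k), algebraMap k Γ(X.left, W) s = (constToPresheaf X).app (op W) s)
  {R R' : Type u} [CommRing R] [CommRing R'] [Algebra k R] [Algebra k R'] (σ : R →ₐ[k] R')

omit instΓ in
/-- Restriction to a smaller open commutes with the change of coefficients `σ ⊗ 1`: `Φ' ∘ (σ ⊗ 1) = (σ ⊗ 1) ∘ Φ` for the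
base-change maps `Φ` over `R` and `Φ'` over `R'` (both `1 ⊗ res`). [cite: Hartshorne2010, Thm. 10.2 (a), proof (p. 81)] -/
theorem baseChangeMap_comp_map_eq [∀ W : X.left.Opens, Algebra k Γ(X.left, W)] {V W : X.left.Opens} (h : W ≤ V)
    {Φ : R ⊗[k] Γ(X.left, V) →ₐ[R] R ⊗[k] Γ(X.left, W)}
    (hΦ : ∀ a s, Φ (a ⊗ₜ s) = a ⊗ₜ X.left.presheaf.map (homOfLE h).op s)
    {Φ' : R' ⊗[k] Γ(X.left, V) →ₐ[R'] R' ⊗[k] Γ(X.left, W)}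
    (hΦ' : ∀ a s, Φ' (a ⊗ₜ s) = a ⊗ₜ X.left.presheaf.map (homOfLE h).op s) (x : R ⊗[k] Γ(X.left, V)) :
    Φ' (Algebra.TensorProduct.map σ (AlgHom.id k Γ(X.left, V)) x) =
      Algebra.TensorProduct.map σ (AlgHom.id k Γ(X.left, W)) (Φ x) := by
  induction x using TensorProduct.induction_on with
  | zero => simp
  | tmul r s => rw [Algebra.TensorProduct.map_tmul, AlgHom.id_apply, hΦ', hΦ, Algebra.TensorProduct.map_tmul, AlgHom.id_apply]
  | add y z hy hz => rw [map_add, map_add, hy, hz, map_add, map_add]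

/-! ## §3 Base change of admissible cocycle-exact gluing data on a principal affine cover -/

variable {ι : Type u} (U : ι → X.left.affineOpens) (b : (j l : ι) → Γ(X.left, (U j).1))
  (hb : ∀ j l, (U j).1 ⊓ (U l).1 = X.left.basicOpen (b j l))
  (ψ : (j l : ι) → R ⊗[k] Γ(X.left, (U j).1 ⊓ (U l).1) ≃ₐ[R] R ⊗[k] Γ(X.left, (U j).1 ⊓ (U l).1))
  (𝔫 : Ideal R) (h𝔫 : IsNilpotent 𝔫) (𝔫' : Ideal R') (hσ𝔫 : ∀ n ∈ 𝔫, σ n ∈ 𝔫')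
  (hψ : ∀ j l x, ψ j l x - x ∈ 𝔫 • (⊤ : Submodule R (R ⊗[k] Γ(X.left, (U j).1 ⊓ (U l).1))))
  (hcoc : ∀ (j l m : ι)
    (Φjl : R ⊗[k] Γ(X.left, (U j).1 ⊓ (U l).1) →ₐ[R] R ⊗[k] Γ(X.left, (U j).1 ⊓ (U l).1 ⊓ (U m).1))
    (_ : ∀ a s, Φjl (a ⊗ₜ s) = a ⊗ₜ X.left.presheaf.map (homOfLE inf_le_left).op s)
    (Φlm : R ⊗[k] Γ(X.left, (U l).1 ⊓ (U m).1) →ₐ[R] R ⊗[k] Γ(X.left, (U j).1 ⊓ (U l).1 ⊓ (U m).1))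
    (_ : ∀ a s, Φlm (a ⊗ₜ s) = a ⊗ₜ X.left.presheaf.map
      (homOfLE (le_inf (inf_le_left.trans inf_le_right) inf_le_right)).op s)
    (Φjm : R ⊗[k] Γ(X.left, (U j).1 ⊓ (U m).1) →ₐ[R] R ⊗[k] Γ(X.left, (U j).1 ⊓ (U l).1 ⊓ (U m).1))
    (_ : ∀ a s, Φjm (a ⊗ₜ s) = a ⊗ₜ X.left.presheaf.map
      (homOfLE (le_inf (inf_le_left.trans inf_le_left) inf_le_right)).op s)
    (ρjl ρlm ρjm : R ⊗[k] Γ(X.left, (U j).1 ⊓ (U l).1 ⊓ (U m).1) ≃ₐ[R]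
      R ⊗[k] Γ(X.left, (U j).1 ⊓ (U l).1 ⊓ (U m).1)),
    (∀ x, ρjl (Φjl x) = Φjl (ψ j l x)) → (∀ x, ρlm (Φlm x) = Φlm (ψ l m x)) →
    (∀ x, ρjm (Φjm x) = Φjm (ψ j m x)) → ρlm * ρjl = ρjm)

include halg hb h𝔫 hσ𝔫 hψ hcoc in
/-- **Base change of admissible cocycle-exact gluing data along `σ : R →ₐ[k] R'`** (brick B5): there are
`R'`-automorphisms `ψ' j l` of `R' ⊗_k Γ(U j ∩ U l)` with `(σ ⊗ 1) ∘ ψ j l = ψ' j l ∘ (σ ⊗ 1)` (the compatibility `hψσ`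
consumed by ★ `existsUnique_baseChangeMap` ∕ `isPullback_baseChangeMap`), ADMISSIBLE modulo any ideal `𝔫' ⊇ σ(𝔫)`, and
COCYCLE-EXACT: by ★ `exists_algEquiv_restrict` ∕ `algEquiv_restrict_unique` the restrictions of `ψ'` to a triple overlap
are the base changes of those of `ψ`, so `ρ'_{lm} ρ'_{jl} = ρ'_{jm}` follows from `hcoc` and §1 uniqueness.
[cite: Hartshorne2010, Thm. 10.2 (a), proof (p. 81)] [cite: StacksProject, Tag 01JA] -/
theorem exists_baseChange_gluingData :
    ∃ ψ' : (j l : ι) → R' ⊗[k] Γ(X.left, (U j).1 ⊓ (U l).1) ≃ₐ[R'] R' ⊗[k] Γ(X.left, (U j).1 ⊓ (U l).1),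
      (∀ j l x, ψ' j l x - x ∈ 𝔫' • (⊤ : Submodule R' (R' ⊗[k] Γ(X.left, (U j).1 ⊓ (U l).1)))) ∧
      (∀ (j l m : ι)
        (Φjl : R' ⊗[k] Γ(X.left, (U j).1 ⊓ (U l).1) →ₐ[R'] R' ⊗[k] Γ(X.left, (U j).1 ⊓ (U l).1 ⊓ (U m).1))
        (_ : ∀ a s, Φjl (a ⊗ₜ s) = a ⊗ₜ X.left.presheaf.map (homOfLE inf_le_left).op s)
        (Φlm : R' ⊗[k] Γ(X.left, (U l).1 ⊓ (U m).1) →ₐ[R'] R' ⊗[k] Γ(X.left, (U j).1 ⊓ (U l).1 ⊓ (U m).1))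
        (_ : ∀ a s, Φlm (a ⊗ₜ s) = a ⊗ₜ X.left.presheaf.map
          (homOfLE (le_inf (inf_le_left.trans inf_le_right) inf_le_right)).op s)
        (Φjm : R' ⊗[k] Γ(X.left, (U j).1 ⊓ (U m).1) →ₐ[R'] R' ⊗[k] Γ(X.left, (U j).1 ⊓ (U l).1 ⊓ (U m).1))
        (_ : ∀ a s, Φjm (a ⊗ₜ s) = a ⊗ₜ X.left.presheaf.map
          (homOfLE (le_inf (inf_le_left.trans inf_le_left) inf_le_right)).op s)
        (ρjl ρlm ρjm : R' ⊗[k] Γ(X.left, (U j).1 ⊓ (U l).1 ⊓ (U m).1) ≃ₐ[R']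
          R' ⊗[k] Γ(X.left, (U j).1 ⊓ (U l).1 ⊓ (U m).1)),
        (∀ x, ρjl (Φjl x) = Φjl (ψ' j l x)) → (∀ x, ρlm (Φlm x) = Φlm (ψ' l m x)) →
        (∀ x, ρjm (Φjm x) = Φjm (ψ' j m x)) → ρlm * ρjl = ρjm) ∧
      (∀ j l x, Algebra.TensorProduct.map σ (AlgHom.id k Γ(X.left, (U j).1 ⊓ (U l).1)) (ψ j l x) =
        ψ' j l (Algebra.TensorProduct.map σ (AlgHom.id k Γ(X.left, (U j).1 ⊓ (U l).1)) x)) := by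
  classical
  -- §1 on every double overlap
  have hψ' := fun j l => exists_algEquiv_baseChange σ (ψ j l)
  choose ψ' hψ'σ using hψ'
  refine ⟨ψ', fun j l y => sub_mem_smul_top_of_baseChange σ hσ𝔫 (hψ j l) (hψ'σ j l) y, ?_,
    fun j l x => (hψ'σ j l x).symm⟩
  intro j l m Φ'jl hΦ'jl Φ'lm hΦ'lm Φ'jm hΦ'jm ρ'jl ρ'lm ρ'jm hρ'jl hρ'lm hρ'jm
  -- the triple overlap as a principal open of each double overlap
  have hW₃jl : (U j).1 ⊓ (U l).1 ⊓ (U m).1 =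
      X.left.basicOpen (X.left.presheaf.map (homOfLE (inf_le_left : (U j).1 ⊓ (U l).1 ≤ (U j).1)).op (b j m)) :=
    inf_eq_basicOpen_map U b hb inf_le_left m
  have hW₃lm : (U j).1 ⊓ (U l).1 ⊓ (U m).1 =
      X.left.basicOpen (X.left.presheaf.map (homOfLE (inf_le_left : (U l).1 ⊓ (U m).1 ≤ (U l).1)).op (b l j)) := by
    rw [← inf_eq_basicOpen_map U b hb inf_le_left j]; ac_rfl
  have hW₃jm : (U j).1 ⊓ (U l).1 ⊓ (U m).1 =
      X.left.basicOpen (X.left.presheaf.map (homOfLE (inf_le_left : (U j).1 ⊓ (U m).1 ≤ (U j).1)).op (b j l)) := by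
    rw [← inf_eq_basicOpen_map U b hb inf_le_left l]; ac_rfl
  -- the `R`-level base-change maps and restrictions (★ F1/F2)
  obtain ⟨Φjl, hΦjl⟩ := exists_baseChangeMap (A' := R) halg ((U j).1 ⊓ (U l).1) ((U j).1 ⊓ (U l).1 ⊓ (U m).1)
    inf_le_left
  obtain ⟨Φlm, hΦlm⟩ := exists_baseChangeMap (A' := R) halg ((U l).1 ⊓ (U m).1) ((U j).1 ⊓ (U l).1 ⊓ (U m).1)
    (le_inf (inf_le_left.trans inf_le_right) inf_le_right)
  obtain ⟨Φjm, hΦjm⟩ := exists_baseChangeMap (A' := R) halg ((U j).1 ⊓ (U m).1) ((U j).1 ⊓ (U l).1 ⊓ (U m).1)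
    (le_inf (inf_le_left.trans inf_le_left) inf_le_right)
  obtain ⟨ρjl, hρjl, -⟩ := exists_algEquiv_restrict halg 𝔫 (isAffineOpen_inf₂ U b hb j l) _ hW₃jl inf_le_left h𝔫
    (ψ j l) (hψ j l) hΦjl
  obtain ⟨ρlm, hρlm, -⟩ := exists_algEquiv_restrict halg 𝔫 (isAffineOpen_inf₂ U b hb l m) _ hW₃lm
    (le_inf (inf_le_left.trans inf_le_right) inf_le_right) h𝔫 (ψ l m) (hψ l m) hΦlm
  obtain ⟨ρjm, hρjm, -⟩ := exists_algEquiv_restrict halg 𝔫 (isAffineOpen_inf₂ U b hb j m) _ hW₃jm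
    (le_inf (inf_le_left.trans inf_le_left) inf_le_right) h𝔫 (ψ j m) (hψ j m) hΦjm
  have hR : ρlm * ρjl = ρjm := hcoc j l m Φjl hΦjl Φlm hΦlm Φjm hΦjm ρjl ρlm ρjm hρjl hρlm hρjm
  -- base-change the restrictions and compare with the given `ρ'` (uniqueness of restriction over `R'`)
  obtain ⟨τjl, hτjl⟩ := exists_algEquiv_baseChange σ ρjl
  obtain ⟨τlm, hτlm⟩ := exists_algEquiv_baseChange σ ρlm
  obtain ⟨τjm, hτjm⟩ := exists_algEquiv_baseChange σ ρjm
  -- a base change `τ` of a restriction `ρ` of `ψ` is a restriction of `ψ'`: check on the image of `σ ⊗ 1`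
  have key : ∀ {V : X.left.Opens} (h : (U j).1 ⊓ (U l).1 ⊓ (U m).1 ≤ V)
      (u : R ⊗[k] Γ(X.left, V) ≃ₐ[R] R ⊗[k] Γ(X.left, V))
      (u' : R' ⊗[k] Γ(X.left, V) ≃ₐ[R'] R' ⊗[k] Γ(X.left, V))
      (_ : ∀ x, u' (Algebra.TensorProduct.map σ (AlgHom.id k _) x) = Algebra.TensorProduct.map σ (AlgHom.id k _) (u x))
      {Φ : R ⊗[k] Γ(X.left, V) →ₐ[R] R ⊗[k] Γ(X.left, (U j).1 ⊓ (U l).1 ⊓ (U m).1)}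
      (_ : ∀ a s, Φ (a ⊗ₜ s) = a ⊗ₜ X.left.presheaf.map (homOfLE h).op s)
      {Φ' : R' ⊗[k] Γ(X.left, V) →ₐ[R'] R' ⊗[k] Γ(X.left, (U j).1 ⊓ (U l).1 ⊓ (U m).1)}
      (_ : ∀ a s, Φ' (a ⊗ₜ s) = a ⊗ₜ X.left.presheaf.map (homOfLE h).op s)
      {ρ : R ⊗[k] Γ(X.left, (U j).1 ⊓ (U l).1 ⊓ (U m).1) ≃ₐ[R] R ⊗[k] Γ(X.left, (U j).1 ⊓ (U l).1 ⊓ (U m).1)}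
      (_ : ∀ x, ρ (Φ x) = Φ (u x))
      {τ : R' ⊗[k] Γ(X.left, (U j).1 ⊓ (U l).1 ⊓ (U m).1) ≃ₐ[R'] R' ⊗[k] Γ(X.left, (U j).1 ⊓ (U l).1 ⊓ (U m).1)}
      (_ : ∀ x, τ (Algebra.TensorProduct.map σ (AlgHom.id k _) x) = Algebra.TensorProduct.map σ (AlgHom.id k _) (ρ x)),
      ∀ y, τ (Φ' y) = Φ' (u' y) := by
    intro V h u u' hu' Φ hΦ Φ' hΦ' ρ hρ τ hτ
    -- both sides are `R'`-algebra maps agreeing on `1 ⊗ s = (σ ⊗ 1)(1 ⊗ s)`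
    have H : (τ : _ →ₐ[R'] _).comp Φ' = Φ'.comp (u' : _ →ₐ[R'] _) := by
      refine Algebra.TensorProduct.ext' fun r s => ?_
      have hs : (1 : R') ⊗ₜ[k] s = Algebra.TensorProduct.map σ (AlgHom.id k _) ((1 : R) ⊗ₜ[k] s) := by
        rw [Algebra.TensorProduct.map_tmul, map_one, AlgHom.id_apply]
      have hr : r ⊗ₜ[k] s = r • ((1 : R') ⊗ₜ[k] s) := by
        rw [TensorProduct.smul_tmul', smul_eq_mul, mul_one]
      change τ (Φ' (r ⊗ₜ[k] s)) = Φ' (u' (r ⊗ₜ[k] s))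
      rw [hr, map_smul, map_smul, map_smul, map_smul, hs, baseChangeMap_comp_map_eq σ h hΦ hΦ', hτ, hρ,
        ← baseChangeMap_comp_map_eq σ h hΦ hΦ', hu']
    intro y
    have := AlgHom.congr_fun H y
    simpa using this
  have eρjl : ρ'jl = τjl := algEquiv_restrict_unique halg (isAffineOpen_inf₂ U b hb j l) _ hW₃jl inf_le_left (ψ' j l)
    hΦ'jl hρ'jl (key inf_le_left (ψ j l) (ψ' j l) (hψ'σ j l) hΦjl hΦ'jl hρjl hτjl)
  have eρlm : ρ'lm = τlm := algEquiv_restrict_unique halg (isAffineOpen_inf₂ U b hb l m) _ hW₃lm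
    (le_inf (inf_le_left.trans inf_le_right) inf_le_right) (ψ' l m) hΦ'lm hρ'lm
    (key (le_inf (inf_le_left.trans inf_le_right) inf_le_right) (ψ l m) (ψ' l m) (hψ'σ l m) hΦlm hΦ'lm hρlm hτlm)
  have eρjm : ρ'jm = τjm := algEquiv_restrict_unique halg (isAffineOpen_inf₂ U b hb j m) _ hW₃jm
    (le_inf (inf_le_left.trans inf_le_left) inf_le_right) (ψ' j m) hΦ'jm hρ'jm
    (key (le_inf (inf_le_left.trans inf_le_left) inf_le_right) (ψ j m) (ψ' j m) (hψ'σ j m) hΦjm hΦ'jm hρjm hτjm)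
  subst eρjl eρlm eρjm
  -- `τlm τjl` and `τjm` are both base changes of `ρlm ρjl = ρjm`
  refine algEquiv_baseChange_unique σ fun x => ?_
  rw [algEquiv_baseChange_mul σ hτlm hτjl, hR, hτjm]

end Cover

end Literature.AlgebraicGeometry.Deformation

end
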